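import Summits.QuantumFields.YangMills.Theorems.SoloBlindCharacterVariance
import HarnessLib

/-!
# SoloBlind — D13: the ratio input of IR-0 from scaled covariance asymptotics

Soloist seat `solo-QuantumFields-blind` (session s15).  The infrared-zero chain of this seat
(`SoloBlindLocalGaussianRatios`, `SoloBlindVarianceFloor`, `SoloBlindRatioInput`,
`SoloBlindCharacterVariance`) proves, for the Wilson plaquette field of every compact simple `G`,
`HasGaussianRatioBound r P → CorrelationLengthDiverges r P` — no `β`-uniform torus-uniform
clustering rate at weak coupling.  The hypothesis `HasGaussianRatioBound` is supplied in prose by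
Theorem A (local Gaussianity of the plaquette two-point function at weak coupling, uniformly in
the volume) and Appendix A (the lattice Maxwell plaquette covariance decays polynomially, not
exponentially) of the seat's paper `paper/local-gaussianity.md`.

This file types that last step.  It introduces the THEOREM-A-SHAPED predicate
`HasScaledCovarianceLimit r A s K`: at each fixed separation `n`, the connected two-point
function of the species `A` on the summit's tori `2S+1`, multiplied by a scaling `s β`
(`s β = β²` for plaquette fields), is within every `ε` of a limit value `K n` for all large `β`
and then all large `S`.  From it, positivity of the scaling, `K 0 > 0`, and the
APPENDIX-A-SHAPED property that `K` is not exponentially small at any rate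
(`∀ m₀ > 0, ∃ n, e^{-m₀ n} K 0 < K n`; a polynomial lower bound `C / n^k ≤ K n` eventually
suffices, `exists_exp_mul_lt_of_polynomial_lowerBound`), the ratio bound follows by elementary
limit algebra (`hasGaussianRatioBound_of_scaledCovarianceLimit`), whence IR-0 for the Wilson
plaquette field (`correlationLengthDiverges_wilsonPlaquette_of_scaledCovarianceLimit`).

So the single analytic input of the kernel chain is now stated in closed form: Theorem A must
deliver `HasScaledCovarianceLimit r P (fun β => β ^ 2) K` with `K n` the squared lattice Maxwell
plaquette covariance at separation `n` (times `N²/2`), and Appendix A the bound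
`K n ≥ C n^{-2d}`.  Nothing here bears on the infrared wall IR-1.
-/

open MeasureTheory Filter Topology
open Literature.MathematicalPhysics.QuantumFieldTheory
open Literature.MathematicalPhysics.QuantumLattice

noncomputable section

namespace Summit.QuantumFields.YangMills.Theorems.SoloBlind

/-! ### Part 1: subexponential sequences -/

/-- A sequence with an eventual polynomial lower bound `C / n^k ≤ K n` (`C > 0`) and `K 0 > 0`
is not exponentially small at any rate: for every `m₀ > 0` some `K n` exceeds `e^{-m₀ n} K 0`. -/
theorem exists_exp_mul_lt_of_polynomial_lowerBound {K : ℕ → ℝ} (hK0 : 0 < K 0)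
    (hK : ∃ C : ℝ, 0 < C ∧ ∃ k : ℕ, ∀ᶠ n : ℕ in atTop, C / (n : ℝ) ^ k ≤ K n)
    {m₀ : ℝ} (hm₀ : 0 < m₀) : ∃ n : ℕ, Real.exp (-(m₀ * n)) * K 0 < K n := by
  obtain ⟨C, hC, k, hKn⟩ := hK
  -- `n^k e^{-m₀ n} → 0`
  have hlim :
      Tendsto (fun n : ℕ => ((n : ℝ) ^ k) * Real.exp (-(m₀ * n))) atTop (𝓝 0) := by
    have h1 : Tendsto (fun n : ℕ => m₀ * (n : ℝ)) atTop atTop :=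
      tendsto_natCast_atTop_atTop.const_mul_atTop hm₀
    have h2 := ((Real.tendsto_pow_mul_exp_neg_atTop_nhds_zero k).comp h1).const_mul
      ((m₀ ^ k)⁻¹)
    rw [mul_zero] at h2
    refine h2.congr fun n => ?_
    have hm : m₀ ^ k ≠ 0 := pow_ne_zero _ hm₀.ne'
    simp only [Function.comp_apply, mul_pow]
    field_simp
  have hev : ∀ᶠ n : ℕ in atTop, ((n : ℝ) ^ k) * Real.exp (-(m₀ * n)) < C / K 0 :=
    hlim.eventually (gt_mem_nhds (div_pos hC hK0))
  obtain ⟨n, hn1, hn2, hn3⟩ := (hev.and (hKn.and (eventually_ge_atTop 1))).exists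
  refine ⟨n, lt_of_lt_of_le ?_ hn2⟩
  have hnk : 0 < (n : ℝ) ^ k := pow_pos (by exact_mod_cast hn3) _
  -- `e^{-m₀ n} K 0 = (n^k e^{-m₀ n}) K 0 / n^k < (C / K 0) K 0 / n^k = C / n^k`
  have : Real.exp (-(m₀ * n)) * K 0 =
      ((n : ℝ) ^ k * Real.exp (-(m₀ * n))) * K 0 / (n : ℝ) ^ k := by
    field_simp
  rw [this, div_lt_div_iff_of_pos_right hnk]
  calc ((n : ℝ) ^ k * Real.exp (-(m₀ * n))) * K 0 < C / K 0 * K 0 :=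
      mul_lt_mul_of_pos_right hn1 hK0
    _ = C := div_mul_cancel₀ C hK0.ne'

/-! ### Part 2: the ratio bound from scaled covariance asymptotics -/

section Ratio

variable {G : Type} [Group G] [TopologicalSpace G] [IsTopologicalGroup G] [CompactSpace G]
  [MeasurableSpace G] [BorelSpace G] [SecondCountableTopology G]

/-- **Theorem-A-shaped input.**  The connected two-point function of the species `A` at each
fixed separation `n` on the tori `2S+1`, scaled by `s β`, converges to `K n` as `S → ∞` and
then `β → ∞`, in the summit's `∀ᶠ β, ∀ᶠ S` sense: for every `ε > 0`, for all large `β` and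
then all large `S`, `|s β · c_{A,A}(n; S, β) - K n| ≤ ε`.  (Plaquette fields: `s β = β²`, `K n`
the squared lattice Maxwell covariance; paper Theorem A with Lemma UI′ for the uniformity in
the volume.) -/
def HasScaledCovarianceLimit (r : LatticeRep G) (A : YMSpecies G) (s : ℝ → ℝ) (K : ℕ → ℝ) :
    Prop :=
  ∀ n : ℕ, ∀ ε : ℝ, 0 < ε → ∀ᶠ β : ℝ in atTop, ∀ᶠ S : ℕ in atTop,
    |s β * latticeConnectedCorr r.ρ β (2 * S + 1) A.F A.F n - K n| ≤ ε

omit [SecondCountableTopology G] in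
/-- **Scaled covariance asymptotics ⇒ the ratio input of IR-0.**  If the scaled two-point
function has limits `K n` (`HasScaledCovarianceLimit`), the scaling is eventually positive,
`K 0 > 0`, and `K` is not exponentially small at any rate, then `HasGaussianRatioBound r A`. -/
theorem hasGaussianRatioBound_of_scaledCovarianceLimit (r : LatticeRep G) (A : YMSpecies G)
    {s : ℝ → ℝ} {K : ℕ → ℝ} (hlim : HasScaledCovarianceLimit r A s K)
    (hs : ∀ᶠ β : ℝ in atTop, 0 < s β) (hK0 : 0 < K 0)
    (hK : ∀ m₀ : ℝ, 0 < m₀ → ∃ n : ℕ, Real.exp (-(m₀ * n)) * K 0 < K n) :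
    HasGaussianRatioBound r A := by
  intro m₀ hm₀
  obtain ⟨n, hn⟩ := hK m₀ hm₀
  -- a ratio strictly between `e^{-m₀ n}` and `K n / K 0`
  have hq : Real.exp (-(m₀ * n)) < K n / K 0 := by rw [lt_div_iff₀ hK0]; exact hn
  set ρ₀ : ℝ := (Real.exp (-(m₀ * n)) + K n / K 0) / 2 with hρ₀_def
  have hρq : Real.exp (-(m₀ * n)) < ρ₀ := by rw [hρ₀_def]; linarith
  have hρK : ρ₀ < K n / K 0 := by rw [hρ₀_def]; linarith
  have hρpos : 0 < ρ₀ := (Real.exp_pos _).trans hρq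
  have hgap : 0 < K n - ρ₀ * K 0 := by
    have := (lt_div_iff₀ hK0).1 hρK; linarith
  -- the tolerance
  set ε : ℝ := (K n - ρ₀ * K 0) / (ρ₀ + 2) with hε_def
  have hε : 0 < ε := div_pos hgap (by linarith)
  have hεle : ε * (ρ₀ + 1) ≤ K n - ρ₀ * K 0 := by
    have h2 : ε * (ρ₀ + 2) = K n - ρ₀ * K 0 := by
      rw [hε_def]; exact div_mul_cancel₀ _ (by linarith)
    nlinarith
  refine ⟨n, ρ₀, hρq, ?_⟩
  filter_upwards [hlim n ε hε, hlim 0 ε hε, hs] with β hβn hβ0 hsβ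
  filter_upwards [hβn, hβ0] with S hSn hS0
  have h1 : K n - ε ≤ s β * latticeConnectedCorr r.ρ β (2 * S + 1) A.F A.F n := by
    have := (abs_le.1 hSn).1; linarith
  have h2 : s β * latticeConnectedCorr r.ρ β (2 * S + 1) A.F A.F 0 ≤ K 0 + ε := by
    have := (abs_le.1 hS0).2; linarith
  have h3 : s β * (ρ₀ * latticeConnectedCorr r.ρ β (2 * S + 1) A.F A.F 0) ≤
      s β * latticeConnectedCorr r.ρ β (2 * S + 1) A.F A.F n := by
    calc s β * (ρ₀ * latticeConnectedCorr r.ρ β (2 * S + 1) A.F A.F 0)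
        = ρ₀ * (s β * latticeConnectedCorr r.ρ β (2 * S + 1) A.F A.F 0) := by ring
      _ ≤ ρ₀ * (K 0 + ε) := mul_le_mul_of_nonneg_left h2 hρpos.le
      _ ≤ K n - ε := by nlinarith
      _ ≤ _ := h1
  exact le_of_mul_le_mul_left h3 hsβ

omit [SecondCountableTopology G] in
/-- The same with the Appendix-A-shaped hypothesis in polynomial form: `K 0 > 0` and an eventual
lower bound `C / n^k ≤ K n` with `C > 0`. -/
theorem hasGaussianRatioBound_of_scaledCovarianceLimit_of_polynomial (r : LatticeRep G)
    (A : YMSpecies G) {s : ℝ → ℝ} {K : ℕ → ℝ} (hlim : HasScaledCovarianceLimit r A s K)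
    (hs : ∀ᶠ β : ℝ in atTop, 0 < s β) (hK0 : 0 < K 0)
    (hK : ∃ C : ℝ, 0 < C ∧ ∃ k : ℕ, ∀ᶠ n : ℕ in atTop, C / (n : ℝ) ^ k ≤ K n) :
    HasGaussianRatioBound r A :=
  hasGaussianRatioBound_of_scaledCovarianceLimit r A hlim hs hK0
    fun _ hm₀ => exists_exp_mul_lt_of_polynomial_lowerBound hK0 hK hm₀

end Ratio

/-! ### Part 3: IR-0 for the Wilson plaquette field from the typed analytic input -/

section Summit

variable {G : Type} [Group G] [TopologicalSpace G] [IsTopologicalGroup G] [CompactSpace G]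
  [MeasurableSpace G] [BorelSpace G] [SecondCountableTopology G]

/-- **IR-0 for the Wilson plaquette field of a compact simple `G` from scaled covariance
asymptotics.**  For `G` simple compact, any lattice representation `r`, spatial directions
`i, j ≠ 0`, `i ≠ j`, and the plaquette field `P = plaquetteObservable r.ρ _ i j`: if
`s β · c_{P,P}` has limits `K n` in the sense of `HasScaledCovarianceLimit` with `s` eventually
positive, `K 0 > 0` and `K n ≥ C / n^k` eventually (`C > 0`) — the content of Theorem A and
Appendix A of the paper, with `s β = β²` — then `CorrelationLengthDiverges r P`: for every rate
`m₀ > 0` the field fails to cluster torus-uniformly at rate `m₀` for all large `β`. -/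
theorem correlationLengthDiverges_wilsonPlaquette_of_scaledCovarianceLimit
    (hG : IsSimpleCompactGroup G) (r : LatticeRep G) {i j : Fin 4} (hi : i ≠ 0) (hj : j ≠ 0)
    (hij : i ≠ j) {s : ℝ → ℝ} {K : ℕ → ℝ}
    (hlim : HasScaledCovarianceLimit r (plaquetteObservable r.ρ r.continuous i j) s K)
    (hs : ∀ᶠ β : ℝ in atTop, 0 < s β) (hK0 : 0 < K 0)
    (hK : ∃ C : ℝ, 0 < C ∧ ∃ k : ℕ, ∀ᶠ n : ℕ in atTop, C / (n : ℝ) ^ k ≤ K n) :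
    CorrelationLengthDiverges r (plaquetteObservable r.ρ r.continuous i j) :=
  correlationLengthDiverges_wilsonPlaquette_of_ratioBound hG r hi hj hij
    (hasGaussianRatioBound_of_scaledCovarianceLimit_of_polynomial r _ hlim hs hK0 hK)

/-- The same along any weak-coupling sequence `β_k → ∞`. -/
theorem eventually_not_clustersAtRate_wilsonPlaquette_of_scaledCovarianceLimit
    (hG : IsSimpleCompactGroup G) (r : LatticeRep G) {i j : Fin 4} (hi : i ≠ 0) (hj : j ≠ 0)
    (hij : i ≠ j) {s : ℝ → ℝ} {K : ℕ → ℝ}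
    (hlim : HasScaledCovarianceLimit r (plaquetteObservable r.ρ r.continuous i j) s K)
    (hs : ∀ᶠ β : ℝ in atTop, 0 < s β) (hK0 : 0 < K 0)
    (hK : ∃ C : ℝ, 0 < C ∧ ∃ k : ℕ, ∀ᶠ n : ℕ in atTop, C / (n : ℝ) ^ k ≤ K n)
    {m₀ : ℝ} (hm₀ : 0 < m₀) {βk : ℕ → ℝ} (hβ : Tendsto βk atTop atTop) :
    ∀ᶠ k in atTop, ¬ ClustersAtRate r (βk k) (plaquetteObservable r.ρ r.continuous i j)
      (plaquetteObservable r.ρ r.continuous i j) m₀ :=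
  hβ.eventually (correlationLengthDiverges_wilsonPlaquette_of_scaledCovarianceLimit hG r hi hj
    hij hlim hs hK0 hK m₀ hm₀)

end Summit

end Summit.QuantumFields.YangMills.Theorems.SoloBlind

end
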